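import Summits.QuantumFields.YangMills.Theorems.UnitScaleTiltProp7SymFrameLinearResponseOfRegPrT3
import Summits.QuantumFields.YangMills.Theorems.UnitScaleTiltProp7CovLinAvgPureGauge
import Summits.QuantumFields.YangMills.Theorems.UnitScaleTiltProp7OneStepDefectT3
import HarnessLib

/-!
# Route `UnitScaleTilt`, crux «MinimiserStabilityRegPr» (stmt-QuantumFields-19200, stub EX), positivity block, pen (b1)-(v) of w7-19200 g10's LOCATE-QCMP-B1 §2 —
# **THE COARSE-GAUGE RESIDUE VANISHES: THE SYMMETRIC FRAMES' LINEAR RESPONSE IS EXACTLY THE COARSE GAUGE FUNCTION OF THE TRUE-LINEARISED TOWER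
# FOR THE STAIR-MEAN CHOICE OF THE COARSE-SITE MAPS** — `fderiv v_k(y) = Λ_k(y)` identically, every level `k ≤ K − n`, every direction

Cell `ym3-torus` (rung R3 — YM₃ on T³; NOT d = 4, NOT the Clay problem).  Width seat `ym3-torus-px13` g11 (frames∕intertwiner lineage; namer ym-ust-19200-w2 g11
2026-08-29T20:45:24Z «(v) … unworded until a frames-lineage seat asks»; LOCATE `LOCATE-B1v-COARSE-GAUGE-RESIDUE-px13g11.md`).  THEOREMS ONLY (0 `def`, 0 `sorry`);
`--supports stmt-QuantumFields-19200 --as helper`; count-neutral.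

THE POINT.  The structure recursion ✓`Prop7TrueLinIterStructure.trueLinIter_structure` writes the true linearised (0.4)-descent as `Q_kA = G_k + P_{V_k}Λ_k` with the
coarse gauge function `Λ_0 = 0`, `Λ_{j+1}(y) = CM_j(G_j)(y) + Λ_j(emb y)` for ARBITRARY coarse-site maps `CM_j`.  The LEG ✓`Prop7QSymEqTrueLinIter.QTwS_apply_eq_trueLinIter_sub_coarseGauge`
writes the symmetric-frame twisted average as `QTwS A c = Q_{K−n}A(ĉ) − P_Ū(rA)(ĉ)` with `rA(y) = fderiv (t ↦ v_{K−n}(t)(y)) 0 A` the linear response of the accumulated symmetric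
frames (`frameTwS = frameAccU (K−n) … ∘ siteShift`).  Hence `QTwS A = G_{K−n} + P_Ū(Λ_{K−n} − rA)`, and w7's LOCATE books the «coarse-gauge residue» `P_Ū(Λ_{K−n} − rA)` as an
M–L estimate (v).  THIS FILE: for the CHOICE `CM_j(ξ)(y) := |Idx|⁻¹·Σ_i covWalkSum V_j ξ (walk (emb y) st_i)` — the frames' OWN covariant stair mean (`st_i = stairWord i.2.1 (off i.1)`)
— one has `fderiv v_k(y) = Λ_k(y)` IDENTICALLY, so the residue is ZERO and `QTwS A c = G_{K−n}(ĉ)` exactly.  Mechanism: the frames' linear response recursion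
✓`Prop7SymFrameLinearResponseOfRegPr.fderiv_frameAccU_succ_apply_covWalkSum_of_regPr` (`fderiv v_{k+1}(y) = |I|⁻¹Σ_i (covWalkSum V_k (ℓ_kA)(st_i) + Ad_{hol_i} fderiv v_k(x_i))`,
`ℓ_kA(b) = fderiv(↑Ū⁽ᵏ⁾[eᵗW♭](b))·(V_k b)*`), the split `ℓ_kA = G_k + P_{V_k}Λ_k`, linearity ✓`covWalkSum_add` and COVARIANT TELESCOPING ✓`Prop7CovLinAvgPureGauge.covWalkSum_pureGauge_walk`
(`covWalkSum V (P_Vξ)(walk x w) = ξ(x) − Ad_{hol}ξ(walkEnd x w)`): `D_k := fderiv v_k − Λ_k` obeys `D_{k+1}(y) = |I|⁻¹Σ_i Ad_{hol_i}D_k(x_i)`, `D_0 = 0` (✓`frameAccU_zero`).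

WHAT IS PROVED (ns `…Theorems.Prop7CoarseGaugeEqFrameResponse`; member `F n K`, background `W` with `RegPr F n K ε₀ W`, window `10¹²L³ε₀ ≤ 1`, SU(2) towers `V k` carrying
the background tower's values (`hV`, ✓px17 `emlIterU_eq_unitsField_iter`), the coarse gauge family `Λ` HYPOTHESIS-DESCRIBED by the stair-mean recursion (def-free)).
* §1 `coe_holT_units_eq_coe_holT` — units-valued and SU(2)-valued fields with equal values have equal transports (`covWalkSum` of a difference is used inline;
  as a named letter it is ✓`Prop7LogRemainderMass.covWalkSum_sub`, outside this import cone).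
* §2 ★★★ `fderiv_frameAccU_eq_coarseGauge` — `∀ k ≤ K − n, ∀ y, fderiv (t ↦ ↑v_k(t)(y)) 0 A = Λ k y`.
HONEST SCOPE.  An IDENTITY over landed letters; no estimate; the (b1) row, `hQcmp`, the γ-row, the print rows, EX and the crux are NOT proved; (iv) `S_k ↔ T^{str}` untouched;
the DEFECT row ✓`Prop7TrueLinIterDefect` is stated for its own `CM` and is not re-read here.

References: T. Bałaban, CMP **98** (1985) 17–51 [Balaban1985Averaging] ((8)–(9) pp.18–19, (56)–(58) p.27, (82) p.30, (97) p.32); CMP **95** (1984) 17–40 [Balaban1984PropagatorsI]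
((1.18)–(1.20) pp.19–20); CMP **102** (1985) 277–309 [Balaban1985Variational] (Prop. 7 p.299).
-/

set_option autoImplicit false

noncomputable section

open scoped Matrix.Norms.L2Operator BigOperators

namespace Summit.QuantumFields.YangMills.Theorems.Prop7CoarseGaugeEqFrameResponse

open Literature.MathematicalPhysics.QuantumFieldTheory.Balaban1983to89
open Literature.MathematicalPhysics.QuantumFieldTheory.Balaban1983to89.T3ContinuumYM3Torus
open T4Continuum BlockAveraging
open T3PrintedRegularMinimiser (RegPr)
open T3SectALandauChart (bgUnits)
open B7Prop1Explicit (expUnit disp)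
open B10Eq27TorusAxialLog (holT transl holT_eq_holAt)
open BlockAveragingEMLLinearisedBackground (covWalkSum covWalkSum_add covWalkSum_smul)
open Summit.QuantumFields.YangMills.Theorems.Prop8Chart (emlIterU)
open Summit.QuantumFields.YangMills.Theorems.Prop7SymAvgTwSym (frameAccU frameAccU_zero)
open Summit.QuantumFields.YangMills.Theorems.Prop7SymFrameLinearResponseOfRegPr (fderiv_frameAccU_succ_apply_covWalkSum_of_regPr)
open Summit.QuantumFields.YangMills.Theorems.Prop7CovLinAvgPureGauge (covWalkSum_pureGauge_walk)
open Summit.QuantumFields.YangMills.Theorems.Prop7HolRatioPerStep (coe_star_mul_self coe_mul_star_self)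
open Summit.QuantumFields.YangMills.Theorems.Prop7OneStepDefect (walkEnd_eq_transl_disp)

/-! ## §1 A letter on transports -/

section Letters

variable {P : Params} {j : ℕ}

/-- **Equal bond values ⇒ equal transports**: a units-valued field of `M₂(ℂ)` and an `SU(2)`-valued field with the same matrix values have the same parallel transport
along every word (both inverses are the matrix inverse of a unitary). [cite: Balaban1985Averaging, (9) p.18] -/
theorem coe_holT_units_eq_coe_holT (U : GaugeField P j (Matrix (Fin 2) (Fin 2) ℂ)ˣ) (V : GaugeField P j (Matrix.specialUnitaryGroup (Fin 2) ℂ))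
    (hV : ∀ b, ((U b : (Matrix (Fin 2) (Fin 2) ℂ)ˣ) : Matrix (Fin 2) (Fin 2) ℂ) = ((V b : Matrix.specialUnitaryGroup (Fin 2) ℂ) : Matrix (Fin 2) (Fin 2) ℂ)) :
    ∀ (x : Site P j) (w : List (B7Prop1Explicit.Letter P.d)),
      ((holT U x w : (Matrix (Fin 2) (Fin 2) ℂ)ˣ) : Matrix (Fin 2) (Fin 2) ℂ) = ((holT V x w : Matrix.specialUnitaryGroup (Fin 2) ℂ) : Matrix (Fin 2) (Fin 2) ℂ)
  | x, [] => by simp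
  | x, (μ, true) :: w => by
    rw [B10Eq27TorusAxialLog.holT_cons_true, B10Eq27TorusAxialLog.holT_cons_true, Units.val_mul, Submonoid.coe_mul, hV,
      coe_holT_units_eq_coe_holT U V hV (x.shift μ) w]
  | x, (μ, false) :: w => by
    rw [B10Eq27TorusAxialLog.holT_cons_false, B10Eq27TorusAxialLog.holT_cons_false, Units.val_mul, Submonoid.coe_mul,
      coe_holT_units_eq_coe_holT U V hV (x.unshift μ) w]
    congr 1
    have hinvV : (((V ⟨x.unshift μ, μ⟩)⁻¹ : Matrix.specialUnitaryGroup (Fin 2) ℂ) : Matrix (Fin 2) (Fin 2) ℂ)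
        = star ((V ⟨x.unshift μ, μ⟩ : Matrix.specialUnitaryGroup (Fin 2) ℂ) : Matrix (Fin 2) (Fin 2) ℂ) := rfl
    have h1 : (((U ⟨x.unshift μ, μ⟩)⁻¹ : (Matrix (Fin 2) (Fin 2) ℂ)ˣ) : Matrix (Fin 2) (Fin 2) ℂ)
        * ((V ⟨x.unshift μ, μ⟩ : Matrix.specialUnitaryGroup (Fin 2) ℂ) : Matrix (Fin 2) (Fin 2) ℂ) = 1 := by
      rw [← hV]; exact Units.inv_mul _
    rw [hinvV]
    calc (((U ⟨x.unshift μ, μ⟩)⁻¹ : (Matrix (Fin 2) (Fin 2) ℂ)ˣ) : Matrix (Fin 2) (Fin 2) ℂ)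
        = (((U ⟨x.unshift μ, μ⟩)⁻¹ : (Matrix (Fin 2) (Fin 2) ℂ)ˣ) : Matrix (Fin 2) (Fin 2) ℂ)
            * (((V ⟨x.unshift μ, μ⟩ : Matrix.specialUnitaryGroup (Fin 2) ℂ) : Matrix (Fin 2) (Fin 2) ℂ)
              * star ((V ⟨x.unshift μ, μ⟩ : Matrix.specialUnitaryGroup (Fin 2) ℂ) : Matrix (Fin 2) (Fin 2) ℂ)) := by
          rw [coe_mul_star_self, mul_one]
      _ = star ((V ⟨x.unshift μ, μ⟩ : Matrix.specialUnitaryGroup (Fin 2) ℂ) : Matrix (Fin 2) (Fin 2) ℂ) := by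
          rw [← mul_assoc, h1, one_mul]

end Letters

/-! ## §2 ★★★ The frames' linear response IS the coarse gauge function (stair-mean choice) -/

variable (F : T3Family) {n K : ℕ}

/-- ★★★ **THE COARSE-GAUGE RESIDUE VANISHES.**  Member `F n K`, background `W` with `RegPr F n K ε₀ W`, window `10¹²L³ε₀ ≤ 1`; `V k` any level-`k` SU(2) fields carrying the values of
the background tower `Ū⁽ᵏ⁾[W♭]` (`hV`); direction `A`.  Let `Λ : (k : ℕ) → Site (F.P K) k → M₂(ℂ)` satisfy the STAIR-MEAN coarse-gauge recursion of the true-linearised tower: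
`Λ 0 = 0` and, for `k + 1 ≤ K − n`,
`Λ (k+1) y = |Idx|⁻¹ • Σ_i covWalkSum (V k) (ℓ_kA − P_{V k}(Λ k)) (walk (emb y) st_i) + Λ k (emb y)`
with `ℓ_kA(b) = fderiv (t ↦ ↑Ū⁽ᵏ⁾[eᵗ·W♭](b)) 0 A · (↑V k b)*` and `P_Vξ(b) = ξ(b₋) − V_b ξ(b₊) V_b*` (= STRUCTURE's `Λ` for `CM_k := ` the frames' covariant stair mean, `G_k = ℓ_kA − P_{V k}Λ k`).
THEN for every `k ≤ K − n` and every level-`k` site `y`: `fderiv (t ↦ ↑(frameAccU k W♭ (eᵗ·W♭) y)) 0 A = Λ k y`.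
Consequently the LEG's residue `P_Ū(Λ_{K−n} − rA)` is `0` and `QTwS W A c = G_{K−n}(ĉ)` for this `CM` (instantiation left to the (b1) pen).
[cite: Balaban1985Averaging, (97) p.32, (82) p.30, (56)–(58) p.27, (8)–(9) pp.18–19; Balaban1984PropagatorsI, (1.18)–(1.20) pp.19–20] -/
theorem fderiv_frameAccU_eq_coarseGauge {ε₀ : ℝ} (hε₀ : 0 < ε₀) (hε : 10 ^ 12 * (F.L : ℝ) ^ 3 * ε₀ ≤ 1)
    (W : GaugeField (F.P K) 0 (Matrix.specialUnitaryGroup (Fin 2) ℂ)) (hreg : RegPr F n K ε₀ W)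
    (V : (k : ℕ) → GaugeField (F.P K) k (Matrix.specialUnitaryGroup (Fin 2) ℂ))
    (hV : ∀ k, k ≤ K - n → ∀ b : PBond (F.P K) k,
      ((emlIterU k (bgUnits F K W) b : (Matrix (Fin 2) (Fin 2) ℂ)ˣ) : Matrix (Fin 2) (Fin 2) ℂ) = ((V k b : Matrix.specialUnitaryGroup (Fin 2) ℂ) : Matrix (Fin 2) (Fin 2) ℂ))
    (A : PBond (F.P K) 0 → Matrix (Fin 2) (Fin 2) ℂ)
    (Λ : (k : ℕ) → Site (F.P K) k → Matrix (Fin 2) (Fin 2) ℂ) (hΛ0 : ∀ x, Λ 0 x = 0)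
    (hΛs : ∀ (k : ℕ), k + 1 ≤ K - n → ∀ y : Site (F.P K) (k + 1),
      Λ (k + 1) y = (Fintype.card (Idx (F.P K)) : ℂ)⁻¹ • (∑ i : Idx (F.P K),
          covWalkSum (V k)
            (fun b => fderiv ℂ (fun t : PBond (F.P K) 0 → Matrix (Fin 2) (Fin 2) ℂ =>
                ((emlIterU k (fun b' => expUnit (t b') * bgUnits F K W b') b : (Matrix (Fin 2) (Fin 2) ℂ)ˣ) : Matrix (Fin 2) (Fin 2) ℂ)) 0 A
                  * star ((V k b : Matrix.specialUnitaryGroup (Fin 2) ℂ) : Matrix (Fin 2) (Fin 2) ℂ)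
              - (Λ k b.src - ((V k b : Matrix.specialUnitaryGroup (Fin 2) ℂ) : Matrix (Fin 2) (Fin 2) ℂ) * Λ k b.tgt
                  * star ((V k b : Matrix.specialUnitaryGroup (Fin 2) ℂ) : Matrix (Fin 2) (Fin 2) ℂ)))
            (walk (emb y) (stairWord i.2.1 (off i.1))))
        + Λ k (emb y)) :
    ∀ k : ℕ, k ≤ K - n → ∀ y : Site (F.P K) k,
      fderiv ℂ (fun t : PBond (F.P K) 0 → Matrix (Fin 2) (Fin 2) ℂ =>
        ((frameAccU k (bgUnits F K W) (fun b => expUnit (t b) * bgUnits F K W b) y : (Matrix (Fin 2) (Fin 2) ℂ)ˣ) : Matrix (Fin 2) (Fin 2) ℂ)) 0 A = Λ k y := by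
  intro k
  induction k with
  | zero =>
    intro _ y
    have hconst : (fun t : PBond (F.P K) 0 → Matrix (Fin 2) (Fin 2) ℂ =>
        ((frameAccU 0 (bgUnits F K W) (fun b => expUnit (t b) * bgUnits F K W b) y : (Matrix (Fin 2) (Fin 2) ℂ)ˣ) : Matrix (Fin 2) (Fin 2) ℂ))
        = fun _ => 1 := by
      funext t; rw [frameAccU_zero, Units.val_one]
    rw [hconst, hΛ0]
    simp
  | succ k ih =>
    intro hk y
    have hk' : k ≤ K - n := Nat.le_of_succ_le hk
    rw [fderiv_frameAccU_succ_apply_covWalkSum_of_regPr hε₀ hε W hreg hk (V k) (hV k hk') y A, hΛs k hk y]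
    -- the background transports: units-valued `holT (Ū⁽ᵏ⁾[W♭])` = `holAt (V k) ∘ walk`
    have hhol : ∀ i : Idx (F.P K),
        ((holT (emlIterU k (bgUnits F K W)) (emb y) (stairWord i.2.1 (off i.1)) : (Matrix (Fin 2) (Fin 2) ℂ)ˣ) : Matrix (Fin 2) (Fin 2) ℂ)
          = ((holAt (V k) (walk (emb y) (stairWord i.2.1 (off i.1))) : Matrix.specialUnitaryGroup (Fin 2) ℂ) : Matrix (Fin 2) (Fin 2) ℂ) := by
      intro i
      rw [coe_holT_units_eq_coe_holT _ (V k) (hV k hk'), holT_eq_holAt]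
    have hholinv : ∀ i : Idx (F.P K),
        (((holT (emlIterU k (bgUnits F K W)) (emb y) (stairWord i.2.1 (off i.1)))⁻¹ : (Matrix (Fin 2) (Fin 2) ℂ)ˣ) : Matrix (Fin 2) (Fin 2) ℂ)
          = star ((holAt (V k) (walk (emb y) (stairWord i.2.1 (off i.1))) : Matrix.specialUnitaryGroup (Fin 2) ℂ) : Matrix (Fin 2) (Fin 2) ℂ) := by
      intro i
      rw [Matrix.coe_units_inv, hhol i]
      exact Matrix.inv_eq_left_inv (coe_star_mul_self _)
    -- the induction hypothesis at the stair endpoints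
    have hIH : ∀ i : Idx (F.P K),
        fderiv ℂ (fun t : PBond (F.P K) 0 → Matrix (Fin 2) (Fin 2) ℂ =>
          ((frameAccU k (bgUnits F K W) (fun b => expUnit (t b) * bgUnits F K W b) (transl (emb y) (disp (stairWord i.2.1 (off i.1)))) :
            (Matrix (Fin 2) (Fin 2) ℂ)ˣ) : Matrix (Fin 2) (Fin 2) ℂ)) 0 A
          = Λ k (walkEnd (emb y) (stairWord i.2.1 (off i.1))) := by
      intro i
      rw [ih hk', walkEnd_eq_transl_disp]
    -- `covWalkSum` of a difference (✓`Prop7LogRemainderMass.covWalkSum_sub`, restated locally to keep the import cone)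
    have hsub : ∀ (Y Y' : PBond (F.P K) k → Matrix (Fin 2) (Fin 2) ℂ) (γ : List (LStep (F.P K) k)),
        covWalkSum (V k) (Y - Y') γ = covWalkSum (V k) Y γ - covWalkSum (V k) Y' γ := by
      intro Y Y' γ
      rw [sub_eq_add_neg, covWalkSum_add, show (-Y') = (-1 : ℂ) • Y' by simp, covWalkSum_smul]
      simp [sub_eq_add_neg]
    -- split the stair sums: `covWalkSum (ℓ − P_VΛ) = covWalkSum ℓ − (Λ(emb y) − Ad_{hol} Λ(x_i))`
    have hsplit : ∀ i : Idx (F.P K),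
        covWalkSum (V k)
            (fun b => fderiv ℂ (fun t : PBond (F.P K) 0 → Matrix (Fin 2) (Fin 2) ℂ =>
                ((emlIterU k (fun b' => expUnit (t b') * bgUnits F K W b') b : (Matrix (Fin 2) (Fin 2) ℂ)ˣ) : Matrix (Fin 2) (Fin 2) ℂ)) 0 A
                  * star ((V k b : Matrix.specialUnitaryGroup (Fin 2) ℂ) : Matrix (Fin 2) (Fin 2) ℂ)
              - (Λ k b.src - ((V k b : Matrix.specialUnitaryGroup (Fin 2) ℂ) : Matrix (Fin 2) (Fin 2) ℂ) * Λ k b.tgt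
                  * star ((V k b : Matrix.specialUnitaryGroup (Fin 2) ℂ) : Matrix (Fin 2) (Fin 2) ℂ)))
            (walk (emb y) (stairWord i.2.1 (off i.1)))
          = covWalkSum (V k)
              (fun b => fderiv ℂ (fun t : PBond (F.P K) 0 → Matrix (Fin 2) (Fin 2) ℂ =>
                  ((emlIterU k (fun b' => expUnit (t b') * bgUnits F K W b') b : (Matrix (Fin 2) (Fin 2) ℂ)ˣ) : Matrix (Fin 2) (Fin 2) ℂ)) 0 A
                    * star ((V k b : Matrix.specialUnitaryGroup (Fin 2) ℂ) : Matrix (Fin 2) (Fin 2) ℂ))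
              (walk (emb y) (stairWord i.2.1 (off i.1)))
            - (Λ k (emb y)
               - ((holAt (V k) (walk (emb y) (stairWord i.2.1 (off i.1))) : Matrix.specialUnitaryGroup (Fin 2) ℂ) : Matrix (Fin 2) (Fin 2) ℂ)
                 * Λ k (walkEnd (emb y) (stairWord i.2.1 (off i.1)))
                 * star ((holAt (V k) (walk (emb y) (stairWord i.2.1 (off i.1))) : Matrix.specialUnitaryGroup (Fin 2) ℂ) : Matrix (Fin 2) (Fin 2) ℂ)) := by
      intro i
      rw [show (fun b : PBond (F.P K) k => fderiv ℂ (fun t : PBond (F.P K) 0 → Matrix (Fin 2) (Fin 2) ℂ =>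
                ((emlIterU k (fun b' => expUnit (t b') * bgUnits F K W b') b : (Matrix (Fin 2) (Fin 2) ℂ)ˣ) : Matrix (Fin 2) (Fin 2) ℂ)) 0 A
                  * star ((V k b : Matrix.specialUnitaryGroup (Fin 2) ℂ) : Matrix (Fin 2) (Fin 2) ℂ)
              - (Λ k b.src - ((V k b : Matrix.specialUnitaryGroup (Fin 2) ℂ) : Matrix (Fin 2) (Fin 2) ℂ) * Λ k b.tgt
                  * star ((V k b : Matrix.specialUnitaryGroup (Fin 2) ℂ) : Matrix (Fin 2) (Fin 2) ℂ)))
            = (fun b : PBond (F.P K) k => fderiv ℂ (fun t : PBond (F.P K) 0 → Matrix (Fin 2) (Fin 2) ℂ =>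
                ((emlIterU k (fun b' => expUnit (t b') * bgUnits F K W b') b : (Matrix (Fin 2) (Fin 2) ℂ)ˣ) : Matrix (Fin 2) (Fin 2) ℂ)) 0 A
                  * star ((V k b : Matrix.specialUnitaryGroup (Fin 2) ℂ) : Matrix (Fin 2) (Fin 2) ℂ))
              - (fun b : PBond (F.P K) k => Λ k b.src - ((V k b : Matrix.specialUnitaryGroup (Fin 2) ℂ) : Matrix (Fin 2) (Fin 2) ℂ) * Λ k b.tgt
                  * star ((V k b : Matrix.specialUnitaryGroup (Fin 2) ℂ) : Matrix (Fin 2) (Fin 2) ℂ)) from rfl,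
        hsub, covWalkSum_pureGauge_walk]
  -- assemble: the pure-gauge telescoping cancels `Λ k (emb y)` and leaves `Ad_{hol_i}(fderiv v_k − Λ_k)(x_i) = 0`
    have hcard : (Fintype.card (Idx (F.P K)) : ℂ) ≠ 0 := by
      exact_mod_cast (Fintype.card_pos (α := Idx (F.P K))).ne'
    have e1 : (Fintype.card (Idx (F.P K)) : ℂ)⁻¹ • (Fintype.card (Idx (F.P K)) • Λ k (emb y)) = Λ k (emb y) := by
      rw [← Nat.cast_smul_eq_nsmul ℂ, smul_smul, inv_mul_cancel₀ hcard, one_smul]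
    simp_rw [hsplit, hIH, hhol, hholinv]
    simp only [Finset.sum_add_distrib, Finset.sum_sub_distrib, Finset.sum_const, Finset.card_univ, smul_add, smul_sub, e1]
    abel

end Summit.QuantumFields.YangMills.Theorems.Prop7CoarseGaugeEqFrameResponse

end
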